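import Summits.ValiantsHypothesis.ValiantsHypothesis.Theses.DivisionGap
import Summits.ValiantsHypothesis.ValiantsHypothesis.Theorems.DivisionGapDefs
import Summits.ValiantsHypothesis.ValiantsHypothesis.Theorems.DivisionGapPerDivisionHardStubFaceDescent
import Summits.ValiantsHypothesis.ValiantsHypothesis.Theorems.DivisionGapPerDivisionHardStubJssContraction
import Summits.ValiantsHypothesis.ValiantsHypothesis.Theorems.DivisionGapPerDivisionHardStubBlockArsenal
import Summits.ValiantsHypothesis.ValiantsHypothesis.Theorems.DivisionGapPerDivisionHardStubSparseRigid
import Summits.ValiantsHypothesis.ValiantsHypothesis.Theorems.DivisionGapPerDivisionHardStubAtomicTorus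
import Summits.ValiantsHypothesis.ValiantsHypothesis.Theorems.DivisionGapPerDivisionHardStubPairPlacement
import Summits.ValiantsHypothesis.ValiantsHypothesis.Theorems.DivisionGapPerDivisionHardStubPairFlip
import Summits.ValiantsHypothesis.ValiantsHypothesis.Theorems.DivisionGapPerDivisionHardStubPairMono

/-!
# Crux `DivisionGap.PerDivisionHard` (stmt-ValiantsHypothesis-5065) — the PAIR-FLIP RUNG, unconditionally

`PerDivisionHard` asks, for every `c` and all large `n`, that every nonzero cofactor
`h ∈ ℝ≥0[x_ij]` satisfies `2^{(log₂ n + c)^c} < L(per_n · h) + L(h)` (monotone fan-in-two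
`complexity` over `ℝ≥0`).  This file proves it for every SUM OF AT MOST TWO PRODUCTS OF BINOMIALS:
`h = Σ_{l ∈ L} a_l · x^{C_l} · ∏_{β ∈ I} F_β^{μ_l β}`, `|L| ≤ 2`, over at most
`2^{n/(log₂ n + e)^e}` nonzero atoms `F_β` with at most two monomials each and pairwise
non-proportional differences (`e = e(c)`), of arbitrary degrees, multiplicities and cost:

* `perDivisionHard_pairBinomial`.

It is the composition `perDivisionHard_pairBinomial_of` of skeleton v7.2 of line
`pair-descent-jss-endpoint` (`Cruxes/PerDivisionHard/Lines/pair_descent_jss_endpoint.lean`, K2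
dossier v4 §3) with every stub a landed theorem.  The new resource is the admissible WEIGHT: at a
good placement two explicit three-level penalty weights that differ in the decision of ONE
separating atom cannot both produce a tie (`stub_pairFlip`).  Examples: the checkerboard /
shifted-tiling sums `∏_{q ∈ Q₁} per₂(q) + ∏_{q ∈ Q₂} per₂(q)`, `h₄ + h₄'`, and every two-term
instance of the refuter's "live danger D" (sums of products of binomials) — none of which is
sparse, of sparse variable graph, a product, or at small atomic distance.
-/

noncomputable section

-- `Summit.ValiantsHypothesis.ValiantsHypothesis.…` is the tree's mandated single-conjunct layout
-- (Sub = Summit), so the duplicated namespace component is intended.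
set_option linter.dupNamespace false

namespace Summit.ValiantsHypothesis.ValiantsHypothesis.Theorems.DivisionGapPerDivisionHard

open MvPolynomial Literature.Computability.AlgebraicComplexity
open scoped NNReal

/-- Two distinct exponent vectors of the same degree differ in both directions. [folklore] -/
theorem PairFlip.exists_lt_and_gt_of_degree_eq {n : ℕ} {s s' : (Fin n × Fin n) →₀ ℕ}
    (hdeg : s.degree = s'.degree) (hne : s ≠ s') :
    ∃ ep em : Fin n × Fin n, s' ep < s ep ∧ s em < s' em := by
  classical
  have hsum : ∑ e, s e = ∑ e, s' e := by
    rw [← Finsupp.degree_eq_sum, ← Finsupp.degree_eq_sum, hdeg]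
  obtain ⟨e₀, he₀⟩ : ∃ e₀, s e₀ ≠ s' e₀ := by
    by_contra hall
    push Not at hall
    exact hne (Finsupp.ext hall)
  have hp : ∃ ep, s' ep < s ep := by
    by_contra hno
    push Not at hno
    have hlt : s e₀ < s' e₀ := lt_of_le_of_ne (hno e₀) he₀
    have : ∑ e, s e < ∑ e, s' e :=
      Finset.sum_lt_sum (fun e _ => hno e) ⟨e₀, Finset.mem_univ _, hlt⟩
    omega
  have hm : ∃ em, s em < s' em := by
    by_contra hno
    push Not at hno
    obtain ⟨ep, hep⟩ := hp
    have : ∑ e, s' e < ∑ e, s e :=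
      Finset.sum_lt_sum (fun e _ => hno e) ⟨ep, Finset.mem_univ _, hep⟩
    omega
  obtain ⟨ep, hep⟩ := hp
  obtain ⟨em, hem⟩ := hm
  exact ⟨ep, em, hep, hem⟩

/-- **The pair-flip rung of `PerDivisionHard`.**  For every `c` there are `e, n₀` such that for
all `n ≥ n₀` and every expression with at most two terms
`Σ_{l∈L} a_l · x^{C_l} · ∏_{β∈I} F_β^{μ_l β}` (`|L| ≤ 2`) over at most `2^{n/(log₂ n+e)^e}` nonzero
atoms with `≤ 2` monomials each and pairwise non-proportional differences, nonzero as a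
polynomial, the pair inequality `2^{(log₂ n + c)^c} < L(per_n · h) + L(h)` holds — any degrees,
multiplicities, cost (e.g. sums of two products of 2×2 permanents on arbitrary tilings).
Composition of the landed stubs of line `pair-descent-jss-endpoint`: torus normal form keeping
the shape (`stub_atomicTorus`), placement by counting with two cells kept outside the face
(`stub_pairPlacement`), then the flip of a separating binomial atom between two three-level
weights (`stub_pairFlip`) or, when all separating atoms are monomials, a digit weight
(`stub_pairMono`); face descent, Jukna–Seiwert–Sergeev contraction, hardness of the placed face.
[folklore] -/
theorem perDivisionHard_pairBinomial :
    ∀ c : ℕ, ∃ e n₀ : ℕ, ∀ n ≥ n₀, ∀ (ι κ : Type) (I : Finset ι) (L : Finset κ)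
      (F : ι → MvPolynomial (Fin n × Fin n) ℝ≥0) (a : κ → ℝ≥0) (C : κ → (Fin n × Fin n) →₀ ℕ)
      (μ : κ → ι → ℕ),
      (∀ β ∈ I, F β ≠ 0 ∧ (F β).support.card ≤ 2) → L.card ≤ 2 →
      (∀ β ∈ I, ∀ β' ∈ I, β ≠ β' → ∀ f ∈ (F β).support, ∀ f' ∈ (F β).support, f ≠ f' →
        ∀ g ∈ (F β').support, ∀ g' ∈ (F β').support, g ≠ g' → ∀ i j : ℤ, (i ≠ 0 ∨ j ≠ 0) →
          ∃ e₀ : Fin n × Fin n, i * ((f e₀ : ℤ) - f' e₀) ≠ j * ((g e₀ : ℤ) - g' e₀)) →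
      (∑ l ∈ L, a l • (monomial (C l) (1 : ℝ≥0) * ∏ β ∈ I, F β ^ μ l β)) ≠ 0 →
      I.card ≤ 2 ^ (n / (Nat.log 2 n + e) ^ e) →
      2 ^ ((Nat.log 2 n + c) ^ c) <
        complexity (perPoly (Fin n) ℝ≥0 *
            ∑ l ∈ L, a l • (monomial (C l) (1 : ℝ≥0) * ∏ β ∈ I, F β ^ μ l β)) +
          complexity (∑ l ∈ L, a l • (monomial (C l) (1 : ℝ≥0) * ∏ β ∈ I, F β ^ μ l β)) := by
  classical
  intro c
  obtain ⟨κ₀, hcon⟩ := stub_jssContraction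
  obtain ⟨d, n₁, hhard⟩ := stub_blockArsenal c κ₀
  obtain ⟨e, n₀, hP⟩ := stub_pairPlacement d
  refine ⟨e, n₀ + n₁ + 1, ?_⟩
  intro n hn ι κ I L F a C μ hF hL hnp hh hI
  have hn1 : 0 < n := by omega
  -- torus normal form, keeping the shape
  obtain ⟨L', F', hL'L, hF', hF'tor, hF'supp, hh', htor, hle1, hle2⟩ :=
    stub_atomicTorus n ι κ I L F a C μ (fun β hβ => (hF β hβ).1) hh
  -- drop the terms with zero coefficient
  set L'' := L'.filter (fun l => a l ≠ 0) with hL''def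
  have hsum'' : (∑ l ∈ L'', a l • (monomial (C l) (1 : ℝ≥0) * ∏ β ∈ I, F' β ^ μ l β)) =
      ∑ l ∈ L', a l • (monomial (C l) (1 : ℝ≥0) * ∏ β ∈ I, F' β ^ μ l β) := by
    rw [hL''def, Finset.sum_filter]
    refine Finset.sum_congr rfl fun l _ => ?_
    by_cases hal : a l = 0
    · simp [hal]
    · simp [hal]
  have hh'ne : (∑ l ∈ L'', a l • (monomial (C l) (1 : ℝ≥0) * ∏ β ∈ I, F' β ^ μ l β)) ≠ 0 := by
    rw [hsum'']; exact hh'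
  have hh'tor : IsTorusHomogeneous
      (∑ l ∈ L'', a l • (monomial (C l) (1 : ℝ≥0) * ∏ β ∈ I, F' β ^ μ l β)) := by
    rw [hsum'']; exact htor
  have hle1' : complexity (perPoly (Fin n) ℝ≥0 *
      ∑ l ∈ L'', a l • (monomial (C l) (1 : ℝ≥0) * ∏ β ∈ I, F' β ^ μ l β)) ≤
      complexity (perPoly (Fin n) ℝ≥0 *
        ∑ l ∈ L, a l • (monomial (C l) (1 : ℝ≥0) * ∏ β ∈ I, F β ^ μ l β)) := by
    rw [hsum'']; exact hle1
  set h' := ∑ l ∈ L'', a l • (monomial (C l) (1 : ℝ≥0) * ∏ β ∈ I, F' β ^ μ l β) with hh'def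
  have hL''card : L''.card ≤ 2 :=
    le_trans (Finset.card_le_card (Finset.filter_subset _ _)) (le_trans (Finset.card_le_card hL'L) hL)
  have ha'' : ∀ l ∈ L'', a l ≠ 0 := fun l hl => (Finset.mem_filter.mp hl).2
  -- the atoms of the normal form: nonzero, `≤ 2` monomials, torus-homogeneous (hence balanced)
  have hF'card : ∀ β ∈ I, (F' β).support.card ≤ 2 := fun β hβ =>
    le_trans (Finset.card_le_card (hF'supp β hβ)) (hF β hβ).2
  have hF'deg : ∀ β ∈ I, ∀ f ∈ (F' β).support, ∀ f' ∈ (F' β).support, f.degree = f'.degree := by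
    intro β hβ f hf f' hf'
    obtain ⟨r₀, c₀, hrc⟩ := hF'tor β hβ
    exact degree_eq_of_rowDegrees_eq ((hrc f hf).1.trans (hrc f' hf').1.symm)
  have hF'all : ∀ β ∈ I, F' β ≠ 0 ∧ (F' β).support.card ≤ 2 ∧
      ∀ f ∈ (F' β).support, ∀ f' ∈ (F' β).support, f.degree = f'.degree :=
    fun β hβ => ⟨hF' β hβ, hF'card β hβ, hF'deg β hβ⟩
  have hnp' : ∀ β ∈ I, ∀ β' ∈ I, β ≠ β' → ∀ f ∈ (F' β).support, ∀ f' ∈ (F' β).support, f ≠ f' →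
      ∀ g ∈ (F' β').support, ∀ g' ∈ (F' β').support, g ≠ g' → ∀ i j : ℤ, (i ≠ 0 ∨ j ≠ 0) →
        ∃ e₀ : Fin n × Fin n, i * ((f e₀ : ℤ) - f' e₀) ≠ j * ((g e₀ : ℤ) - g' e₀) :=
    fun β hβ β' hβ' hne f hf f' hf' hff' g hg g' hg' hgg' =>
      hnp β hβ β' hβ' hne f (hF'supp β hβ hf) f' (hF'supp β hβ hf') hff'
        g (hF'supp β' hβ' hg) g' (hF'supp β' hβ' hg') hgg'
  have hdegh' : ∀ m₁ ∈ h'.support, ∀ m₂ ∈ h'.support, m₁.degree = m₂.degree := by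
    intro m₁ hm₁ m₂ hm₂
    obtain ⟨r₀, c₀, hrc⟩ := hh'tor
    exact degree_eq_of_rowDegrees_eq ((hrc m₁ hm₁).1.trans (hrc m₂ hm₂).1.symm)
  by_contra hlt
  have hle : complexity (perPoly (Fin n) ℝ≥0 *
        ∑ l ∈ L, a l • (monomial (C l) (1 : ℝ≥0) * ∏ β ∈ I, F β ^ μ l β)) +
      complexity (∑ l ∈ L, a l • (monomial (C l) (1 : ℝ≥0) * ∏ β ∈ I, F β ^ μ l β)) ≤
      2 ^ ((Nat.log 2 n + c) ^ c) := not_lt.mp hlt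
  -- a K2 witness for `h'`: placement, then flip or mono
  have hK2 : ∃ (b k m : ℕ) (eR eC : BlockV b k m ≃ Fin n) (w : Fin n × Fin n → ℕ)
      (u : (Fin n × Fin n) →₀ ℕ), (Nat.log 2 n + d) ^ d ≤ b ∧ CutsOut w (placedBlock eR eC) ∧
        HasSingleGPart (placedBlock eR eC) w h' u := by
    by_cases hsep : ∃ l₁ ∈ L'', ∃ l₂ ∈ L'', ∃ β₀ ∈ I, μ l₁ β₀ ≠ μ l₂ β₀ ∧ (F' β₀).support.card = 2
    · -- FLIP: a separating binomial atom
      obtain ⟨l₁, hl₁, l₂, hl₂, β₀, hβ₀, hμ, hcard⟩ := hsep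
      have hl₁₂ : l₁ ≠ l₂ := by rintro rfl; exact hμ rfl
      obtain ⟨s, hs, s', hs', hss'⟩ := Finset.one_lt_card.mp (by omega : 1 < (F' β₀).support.card)
      obtain ⟨ep, em, hep, hem⟩ :=
        PairFlip.exists_lt_and_gt_of_degree_eq (hF'deg β₀ hβ₀ s hs s' hs') hss'
      obtain ⟨b, k, m, eR, eC, hb, hk, hepG, hemG, H1, H2, -⟩ :=
        hP n (by omega) ι κ I L'' F' a C μ ep em (fun β hβ => ⟨hF' β hβ, hF'card β hβ, hF'tor β hβ⟩)
          hI hL''card ha'' hnp' hh'ne hh'tor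
      obtain ⟨g₀, hg₀⟩ := exists_blockMatching b k m hk
      obtain ⟨σ₀, hσ₀⟩ := exists_perm_mem_placedBlock eR eC g₀ hg₀
      obtain ⟨w, hcut, u, hu⟩ := stub_pairFlip n (placedBlock eR eC) ι κ I L'' F' a C μ l₁ l₂ β₀
        s s' ep em ⟨σ₀, hσ₀⟩ hF'all hL''card ha'' hdegh' H1 hl₁ hl₂ hl₁₂ hβ₀ hμ hs hs' hss'
        hepG hemG hep hem
        (fun β hβ hne f hf f' hf' hff' i j hij => H2 β hβ β₀ hβ₀ hne f hf f' hf' hff' s hs s' hs' hss' i j hij)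
      exact ⟨b, k, m, eR, eC, w, u, hb, hcut, hu⟩
    · -- MONO: every separating atom is a monomial
      push Not at hsep
      have hmono : ∀ l₁ ∈ L'', ∀ l₂ ∈ L'', ∀ β ∈ I, μ l₁ β ≠ μ l₂ β → (F' β).support.card = 1 := by
        intro l₁ hl₁ l₂ hl₂ β hβ hμ
        have h2 := hsep l₁ hl₁ l₂ hl₂ β hβ hμ
        have hpos : 0 < (F' β).support.card :=
          Finset.card_pos.mpr (support_nonempty.mpr (hF' β hβ))
        have := hF'card β hβ
        omega
      obtain ⟨b, k, m, eR, eC, hb, hk, -, -, H1, -, H3⟩ :=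
        hP n (by omega) ι κ I L'' F' a C μ (⟨0, hn1⟩, ⟨0, hn1⟩) (⟨0, hn1⟩, ⟨0, hn1⟩)
          (fun β hβ => ⟨hF' β hβ, hF'card β hβ, hF'tor β hβ⟩) hI hL''card ha'' hnp' hh'ne hh'tor
      obtain ⟨g₀, hg₀⟩ := exists_blockMatching b k m hk
      obtain ⟨σ₀, hσ₀⟩ := exists_perm_mem_placedBlock eR eC g₀ hg₀
      obtain ⟨w, hcut, u, hu⟩ := stub_pairMono n (placedBlock eR eC) ι κ I L'' F' a C μ ⟨σ₀, hσ₀⟩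
        hF'all ha'' hdegh' H1 hmono (fun l₁ hl₁ l₂ hl₂ => H3 l₁ hl₁ l₂ hl₂ (hmono l₁ hl₁ l₂ hl₂))
      exact ⟨b, k, m, eR, eC, w, u, hb, hcut, hu⟩
  obtain ⟨b, k, m, eR, eC, w, u, hb, hcut, hsingle⟩ := hK2
  have hdesc := stub_faceDescent n (placedBlock eR eC) w h' u hcut hh'ne hsingle
  have h1 : complexity (monomial u (1 : ℝ≥0) * facePer (placedBlock eR eC)) ≤
      2 ^ ((Nat.log 2 n + c) ^ c) + 1 :=
    calc complexity (monomial u (1 : ℝ≥0) * facePer (placedBlock eR eC))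
        ≤ complexity (perPoly (Fin n) ℝ≥0 * h') + 1 := hdesc
      _ ≤ complexity (perPoly (Fin n) ℝ≥0 *
            ∑ l ∈ L, a l • (monomial (C l) (1 : ℝ≥0) * ∏ β ∈ I, F β ^ μ l β)) + 1 :=
          Nat.add_le_add_right hle1' 1
      _ ≤ 2 ^ ((Nat.log 2 n + c) ^ c) + 1 :=
          Nat.add_le_add_right (le_trans (Nat.le_add_right _ _) hle) 1
  have h2 : complexity (facePer (placedBlock eR eC)) ≤
      ((n + 2) * (2 ^ ((Nat.log 2 n + c) ^ c) + 3)) ^ κ₀ :=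
    calc complexity (facePer (placedBlock eR eC))
        ≤ ((n + 2) * (complexity (monomial u (1 : ℝ≥0) * facePer (placedBlock eR eC)) + 2)) ^ κ₀ :=
          hcon n (facePer (placedBlock eR eC)) u
      _ ≤ ((n + 2) * (2 ^ ((Nat.log 2 n + c) ^ c) + 3)) ^ κ₀ :=
          Nat.pow_le_pow_left (Nat.mul_le_mul_left _ (by omega)) κ₀
  have h3 := hhard n (by omega) b k m eR eC hb
  exact absurd (lt_of_lt_of_le h3 h2) (lt_irrefl _)

end Summit.ValiantsHypothesis.ValiantsHypothesis.Theorems.DivisionGapPerDivisionHard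

end
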